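import Literature.AlgebraicGeometry.AbelianSchemes.AbelianSchemeDualPair
import Literature.AlgebraicGeometry.Motives.AbelianVarietyProofs
import Mathlib.AlgebraicGeometry.Fiber
import HarnessLib

/-!
# An abelian scheme over a connected base has connected total space and a well-defined relative dimension

Layer `Literature/AlgebraicGeometry/AbelianSchemes`, namespace `Literature.AlgebraicGeometry.AbelianSchemes.AbelianSchemeOver` (and one generic
lemma in `Literature.AlgebraicGeometry.Motives`).  THEOREMS ONLY (no `def`, no instance, no notation, no `sorry`).  Cell `hodgecm-mathlib`
(D-0151), F-3 (M) child line, gap (G6) of B-typ04 (g15)'s child-line header («`A.IsOfRelDim g` exists only per connected component of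
`Spec R`; (Ma0) binds `g`, (Ma) does not expose it») — the (Ma) ∃-prefix assembly needs `∃ g, A.IsOfRelDim g` over its CONNECTED base.
HC_CM is proved only modulo the 7 printed citations until rung 0 closes; nothing here is about HC.

* `Motives.exists_smoothOfRelativeDimension_of_smooth_of_connectedSpace` — a smooth morphism with CONNECTED source is smooth of some
  (single) relative dimension: the relative dimension is locally constant on the source (★ `exists_opens_smoothOfRelativeDimension_of_smooth`)
  and two charts that meet have the same dimension (★ `AbelianVarietyProofs.eq_of_smoothOfRelativeDimension`), so the loci of fixed local
  dimension form an open partition of the source ([GortzWedhorn2020] Prop. 6.15 (1) / Remark 16.54; ★ has the IRREDUCIBLE-source case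
  `exists_smoothOfRelativeDimension_of_smooth`);
* `AbelianSchemeOver.connectedSpace_left` — the total space of an abelian scheme over a connected base is connected (`A → S` is surjective
  (unit section), closed (proper) — hence a quotient map — with connected fibres; [StacksProject, Tag 0377]);
* `AbelianSchemeOver.exists_isOfRelDim` — hence `∃ g, A.IsOfRelDim g` over a connected base ([MumfordFogartyKirwan1994] Def. 7.2 (i)
  «an abelian scheme `X` over `S` of dimension `g`»).

## References
* [GortzWedhorn2020] U. Görtz, T. Wedhorn, *Algebraic Geometry I*, 2nd ed. (2020), Prop. 6.15 (1), Remark 16.54 (p. 539).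
* [StacksProject] The Stacks Project, Tag 0377 (connected fibres and a quotient map give a connected total space).
* [MumfordFogartyKirwan1994] D. Mumford, J. Fogarty, F. Kirwan, *Geometric Invariant Theory*, 3rd ed. (1994), Ch. 7 §2 Definition 7.2 (p. 129).
-/

noncomputable section

universe u

open CategoryTheory CategoryTheory.Limits AlgebraicGeometry Topology

namespace Literature.AlgebraicGeometry.Motives

variable {X Y : Scheme.{u}} (f : X ⟶ Y)

/-- **A smooth morphism with connected source is smooth of some relative dimension** (everywhere the same one): the relative dimension
is locally constant on the source and constant along chains of meeting charts, hence constant on a connected source.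
[cite: GortzWedhorn2020, Prop. 6.15 (1) and Remark 16.54 (p. 539)] -/
theorem exists_smoothOfRelativeDimension_of_smooth_of_connectedSpace [ConnectedSpace X] [Smooth f] :
    ∃ n : ℕ, SmoothOfRelativeDimension n f := by
  classical
  choose V d hxV hV using exists_opens_smoothOfRelativeDimension_of_smooth f
  -- the locus of local relative dimension `n`
  let W : ℕ → X.Opens := fun n => ⨆ x : {x : X // d x = n}, V x.1
  have hWmem : ∀ x : X, x ∈ W (d x) := fun x => TopologicalSpace.Opens.mem_iSup.mpr ⟨⟨x, rfl⟩, hxV x⟩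
  -- two charts that meet have the same dimension
  have hdd : ∀ x y : X, ((V x ⊓ V y : X.Opens) : Set X).Nonempty → d x = d y := by
    intro x y hne
    haveI : Nonempty ((V x ⊓ V y : X.Opens) : Scheme.{u}) := by
      obtain ⟨z, hz⟩ := hne
      exact ⟨⟨z, hz⟩⟩
    have h₁ : SmoothOfRelativeDimension (d x) ((V x ⊓ V y).ι ≫ f) := by
      rw [← X.homOfLE_ι (inf_le_left : V x ⊓ V y ≤ V x), Category.assoc]
      exact IsZariskiLocalAtSource.comp (hV x) _
    have h₂ : SmoothOfRelativeDimension (d y) ((V x ⊓ V y).ι ≫ f) := by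
      rw [← X.homOfLE_ι (inf_le_right : V x ⊓ V y ≤ V y), Category.assoc]
      exact IsZariskiLocalAtSource.comp (hV y) _
    exact AbelianVarietyProofs.eq_of_smoothOfRelativeDimension _ h₁ h₂
  -- the loci `W n` are pairwise disjoint, so each is clopen
  have hWdisj : ∀ {m n : ℕ}, m ≠ n → Disjoint ((W m : X.Opens) : Set X) (W n) := by
    intro m n hmn
    rw [Set.disjoint_left]
    intro z hzm hzn
    obtain ⟨⟨x, rfl⟩, hx⟩ := TopologicalSpace.Opens.mem_iSup.mp hzm
    obtain ⟨⟨y, rfl⟩, hy⟩ := TopologicalSpace.Opens.mem_iSup.mp hzn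
    exact hmn (hdd x y ⟨z, hx, hy⟩)
  obtain ⟨x₀⟩ := (inferInstance : Nonempty X)
  refine ⟨d x₀, ?_⟩
  have hWclosed : IsClosed ((W (d x₀) : X.Opens) : Set X) := by
    have hcompl : ((W (d x₀) : X.Opens) : Set X)ᶜ = ⋃ n : {n : ℕ // n ≠ d x₀}, ((W n.1 : X.Opens) : Set X) := by
      ext z
      simp only [Set.mem_compl_iff, Set.mem_iUnion]
      constructor
      · intro hz
        exact ⟨⟨d z, fun h => hz (h ▸ hWmem z)⟩, hWmem z⟩
      · rintro ⟨⟨n, hn⟩, hz⟩ hz₀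
        exact Set.disjoint_left.mp (hWdisj hn) hz hz₀
    rw [← isOpen_compl_iff, hcompl]
    exact isOpen_iUnion fun n => (W n.1).2
  have hWuniv : ((W (d x₀) : X.Opens) : Set X) = Set.univ :=
    IsClopen.eq_univ ⟨hWclosed, (W (d x₀)).2⟩ ⟨x₀, hWmem x₀⟩
  -- every local dimension is `d x₀`, and smoothness of relative dimension is local on the source
  have hd : ∀ x, d x = d x₀ := fun x => by
    have hx : x ∈ ((W (d x₀) : X.Opens) : Set X) := by rw [hWuniv]; exact Set.mem_univ x
    obtain ⟨⟨y, hy⟩, hxy⟩ := TopologicalSpace.Opens.mem_iSup.mp hx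
    rw [← hy]
    exact hdd x y ⟨x, hxV x, hxy⟩
  have hcov : iSup V = ⊤ := by
    rw [eq_top_iff]
    rintro x -
    exact TopologicalSpace.Opens.mem_iSup.mpr ⟨x, hxV x⟩
  exact IsZariskiLocalAtSource.of_iSup_eq_top (P := @SmoothOfRelativeDimension (d x₀)) V hcov
    fun x => hd x ▸ hV x

end Literature.AlgebraicGeometry.Motives

namespace Literature.AlgebraicGeometry.AbelianSchemes

namespace AbelianSchemeOver

variable {S : Scheme.{u}} (A : AbelianSchemeOver S)

/-- **The total space of an abelian scheme over a connected base is connected**: `A → S` is surjective (it has the unit section) and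
closed (proper), hence a topological quotient map, and its fibres `A_s` are connected (geometrically connected fibres), so the preimage
of the connected `S` is connected. [cite: StacksProject, Tag 0377] [cite: MumfordFogartyKirwan1994, Ch. 6 §1 Definition 6.1 (p. 115)] -/
theorem connectedSpace_left [ConnectedSpace S] : ConnectedSpace A.X.left := by
  haveI := A.isProper
  -- surjective: the unit section
  have hsurj : Function.Surjective A.X.hom := fun s =>
    ⟨A.unitSection s, by rw [← Scheme.Hom.comp_apply, A.unitSection_comp_hom]; rfl⟩
  -- quotient map: closed, continuous, surjective
  have hq : IsQuotientMap A.X.hom := A.X.hom.isClosedMap.isQuotientMap A.X.hom.continuous hsurj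
  -- connected fibres: the fibre over `s` is the image of the connected scheme `A ×_S Spec κ(s)`
  have hfib : ∀ s : S, _root_.IsConnected (A.X.hom ⁻¹' {s}) := fun s => by
    haveI : ConnectedSpace ↥(A.X.hom.fiber s) :=
      A.connectedSpace_pullback (S.residueField s) (S.fromSpecResidueField s)
    rw [← Scheme.Hom.range_fiberι]
    exact isConnected_range (A.X.hom.fiberι s).continuous
  have h := hq.isCoinducing.isConnected_preimage_of_isClosed hfib isClosed_univ
    (isConnected_univ (α := S))
  rw [Set.preimage_univ] at h
  exact connectedSpace_iff_univ.mpr h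

/-- **An abelian scheme over a connected base has a relative dimension**: `∃ g, A.IsOfRelDim g` ([MumfordFogartyKirwan1994] Def. 7.2 (i)
«of dimension `g`»; the relative dimension of the smooth `A → S` is constant on the connected total space).
[cite: MumfordFogartyKirwan1994, Ch. 7 §2 Definition 7.2 (p. 129)] [cite: GortzWedhorn2020, Remark 16.54 (p. 539)] -/
theorem exists_isOfRelDim [ConnectedSpace S] : ∃ g : ℕ, A.IsOfRelDim g := by
  haveI := A.isSmooth
  haveI := A.connectedSpace_left
  exact Motives.exists_smoothOfRelativeDimension_of_smooth_of_connectedSpace A.X.hom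

end AbelianSchemeOver

end Literature.AlgebraicGeometry.AbelianSchemes

end
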